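import Summits.CriticalPhenomena.SAWScalingLimit.Theorems.SAWDefectDecoherenceBoundaryClosureRIdentificationGateHopf
import Mathlib.Analysis.Calculus.Deriv.Slope
import Literature.Analysis.Complex.SchwarzReflection
import HarnessLib

/-!
# Boundary data transfer, II: linear normal growth from a tangential lower bound (Schwarz reflection)

Route `SAWDefectDecoherence`, crux `BoundaryClosureR` (stmt-CriticalPhenomena-14004), line
`pick-half-plane`, stub `stub_boundaryDataTransfer` (r11 stub 5c), clause (I4) of the landed
`pickEngine_stage2`: at a flat point `y` the engine wants a half-disc of continuity whose diameter is
mapped into a line `p' + e^{iθ'}ℝ` with AT LEAST LINEAR NORMAL GROWTH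
`c'·t ≤ |Im(e^{−iθ'}(h(y + it) − p'))|`.  The lattice supplies (in the limit) something TANGENTIAL: the
diameter is mapped into a line through `h y` of unit direction `u`, and the boundary profile is
bi-Lipschitz from below in the symmetric form `c·t ≤ ‖h(y + t) − h(y − t)‖`.  This file is the
classical bridge (pure complex analysis, no lattice):

* `growth_of_tangential` — `h` holomorphic on the open upper half-disc at `y`, continuous on the
  closed one, diameter into the line `h y + uℝ` (`‖u‖ = 1`), and `c·t ≤ ‖h(y+t) − h(y−t)‖` for
  `0 < t < ρ` ⟹ for some `0 < ρ' ≤ ρ`, `c' > 0`, `θ' = arg u`, `p' = h y`: the line condition and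
  the normal growth on `(0, ρ')`.  Proof: Schwarz-reflect `R` of `e^{−iθ'}(h(· + y) − h y)`
  (`Complex.differentiableOn_schwarzReflection`, in the tree); `R'(0)` is REAL
  (`im_deriv_eq_zero_of_real`, in the tree) and `‖R'(0)‖ ≥ c/2` (symmetric difference quotients
  along the axis); then `Im R(it) = Re R'(0)·t + o(t)`.
* `boundaryDataTransfer_reflectionGrowth` — the registered ∀-closed form.

References: Conway, *Functions of One Complex Variable I* (1978), IX.1.1.
-/

noncomputable section

open scoped Topology ComplexConjugate
open Filter Set Metric Complex
open Summit.CriticalPhenomena.SAWScalingLimit.Theorems.PickHalfPlane.Identification (im_deriv_eq_zero_of_real)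

namespace Summit.CriticalPhenomena.SAWScalingLimit.Theorems.PickHalfPlane.BoundaryDataTransfer

/-- The symmetric difference quotient `(R t − R(−t))/t` of a function differentiable at `0` tends to
`2 R'(0)` as `t → 0⁺` along the reals. [folklore] -/
theorem tendsto_symm_slope {R : ℂ → ℂ} {d : ℂ} (hR : HasDerivAt R d 0) :
    Tendsto (fun t : ℝ => (R t - R (-t)) / (t : ℂ)) (𝓝[>] 0) (𝓝 (2 * d)) := by
  have hslope := hR.tendsto_slope_zero
  -- along `t` and along `−t`
  have hp : Tendsto (fun t : ℝ => ((t : ℂ))) (𝓝[>] (0 : ℝ)) (𝓝[≠] (0 : ℂ)) :=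
    tendsto_nhdsWithin_iff.2 ⟨(continuous_ofReal.tendsto' 0 0 ofReal_zero).mono_left
      nhdsWithin_le_nhds, eventually_mem_nhdsWithin.mono fun s hs => by
        simpa using (ne_of_gt (show (0 : ℝ) < s from hs))⟩
  have hm : Tendsto (fun t : ℝ => (((-t : ℝ) : ℂ))) (𝓝[>] (0 : ℝ)) (𝓝[≠] (0 : ℂ)) :=
    tendsto_nhdsWithin_iff.2 ⟨by
      have : Tendsto (fun t : ℝ => (((-t : ℝ) : ℂ))) (𝓝 0) (𝓝 (((-0 : ℝ) : ℂ))) :=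
        (continuous_ofReal.comp continuous_neg).tendsto 0
      simpa using this.mono_left nhdsWithin_le_nhds, eventually_mem_nhdsWithin.mono fun s hs => by
        simpa using (ne_of_gt (show (0 : ℝ) < s from hs))⟩
  have h1 := hslope.comp hp
  have h2 := hslope.comp hm
  have hsum := h1.add h2
  rw [← two_mul] at hsum
  refine hsum.congr' ?_
  filter_upwards [self_mem_nhdsWithin] with t ht
  have ht0 : (t : ℂ) ≠ 0 := by exact_mod_cast (ne_of_gt (show (0 : ℝ) < t from ht))
  simp only [Function.comp_apply, zero_add, smul_eq_mul, ofReal_neg]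
  field_simp
  ring

/-- **Linear normal growth from a tangential lower bound.**  Let `h` be holomorphic on the open
upper half-disc `{im z > im y} ∩ B(y, ρ)`, continuous on the closed upper half-disc, mapping the
diameter into the line `h y + u·ℝ` (`‖u‖ = 1`), with `c·t ≤ ‖h(y + t) − h(y − t)‖` for `0 < t < ρ`
(`c > 0`).  Then for some `0 < ρ' ≤ ρ`, `c' > 0`, with `θ' = arg u` and `p' = h y`: the diameter of
`B(y, ρ')` is mapped into `p' + e^{iθ'}ℝ` and `c'·t ≤ |Im(e^{−iθ'}(h(y + it) − p'))|` for
`0 < t < ρ'`.  (Schwarz reflection; `R'(0)` real with `‖R'(0)‖ ≥ c/2`; first-order expansion along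
the normal.) [folklore] -/
theorem growth_of_tangential {y u : ℂ} {ρ c : ℝ} {h : ℂ → ℂ} (hρ : 0 < ρ) (hc : 0 < c) (hu : ‖u‖ = 1)
    (hdiff : DifferentiableOn ℂ h ({z : ℂ | y.im < z.im} ∩ ball y ρ))
    (hcont : ContinuousOn h ({z : ℂ | y.im ≤ z.im} ∩ ball y ρ))
    (hline : ∀ z ∈ ball y ρ, z.im = y.im → ∃ s : ℝ, h z - h y = u * s)
    (htan : ∀ t : ℝ, 0 < t → t < ρ → c * t ≤ ‖h (y + t) - h (y - t)‖) :
    ∃ ρ' : ℝ, 0 < ρ' ∧ ρ' ≤ ρ ∧ ∃ c' : ℝ, 0 < c' ∧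
      (∀ z ∈ ball y ρ', z.im = y.im →
        (exp (-((u.arg : ℂ) * I)) * (h z - h y)).im = 0) ∧
      (∀ t : ℝ, 0 < t → t < ρ' →
        c' * t ≤ |(exp (-((u.arg : ℂ) * I)) * (h (y + (t : ℂ) * I) - h y)).im|) := by
  -- `u = e^{iθ'}`
  set θ' : ℝ := u.arg with hθ'
  have hu_eq : u = exp ((θ' : ℂ) * I) := by
    have := Complex.norm_mul_exp_arg_mul_I u
    rw [hu, ofReal_one, one_mul] at this
    exact this.symm
  have hrot : exp (-((θ' : ℂ) * I)) * u = 1 := by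
    rw [hu_eq, ← Complex.exp_add, show -((θ' : ℂ) * I) + (θ' : ℂ) * I = 0 by ring, Complex.exp_zero]
  -- the translated and rotated function and its reflection
  set F : ℂ → ℂ := fun w => exp (-((θ' : ℂ) * I)) * (h (w + y) - h y) with hF
  set U₀ : Set ℂ := ball (0 : ℂ) ρ with hU₀
  have hU₀symm : ∀ w ∈ U₀, conj w ∈ U₀ := fun w hw => by
    simpa [hU₀, mem_ball, dist_eq_norm] using hw
  have hshift : ∀ {w : ℂ}, w ∈ U₀ → w + y ∈ ball y ρ := fun {w} hw => by
    simpa [hU₀, mem_ball, dist_eq_norm] using hw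
  have hFc : ContinuousOn F (U₀ ∩ {w | 0 ≤ w.im}) := by
    have h1 : ContinuousOn (fun w => h (w + y)) (U₀ ∩ {w | 0 ≤ w.im}) := by
      refine hcont.comp (continuous_id.add continuous_const).continuousOn ?_
      rintro w ⟨hw, hwim⟩
      exact ⟨by show y.im ≤ (w + y).im; simpa using hwim, hshift hw⟩
    exact continuousOn_const.mul (h1.sub continuousOn_const)
  have hUopen : IsOpen ({z : ℂ | y.im < z.im} ∩ ball y ρ) :=
    (isOpen_lt continuous_const continuous_im).inter isOpen_ball
  have hFd : DifferentiableOn ℂ F (U₀ ∩ {w | 0 < w.im}) := by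
    rintro w ⟨hw, hwim⟩
    have hwim' : 0 < w.im := hwim
    have hmem : w + y ∈ {z : ℂ | y.im < z.im} ∩ ball y ρ :=
      ⟨by show y.im < (w + y).im; simpa using hwim', hshift hw⟩
    have hd : DifferentiableAt ℂ h (w + y) := (hdiff _ hmem).differentiableAt (hUopen.mem_nhds hmem)
    have h1 : DifferentiableAt ℂ (fun w => h (w + y)) w :=
      hd.comp w (differentiableAt_id.add (differentiableAt_const y))
    exact ((differentiableAt_const _).mul (h1.sub (differentiableAt_const _))).differentiableWithinAt
  -- `F` is real on the axis: the line condition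
  have hFreal_im : ∀ w ∈ U₀, w.im = 0 → (F w).im = 0 := by
    intro w hw hwim
    obtain ⟨s, hs⟩ := hline (w + y) (hshift hw) (by simp [hwim])
    show (exp (-((θ' : ℂ) * I)) * (h (w + y) - h y)).im = 0
    rw [hs, ← mul_assoc, hrot, one_mul, ofReal_im]
  have hFreal : ∀ w ∈ U₀, w.im = 0 → conj (F w) = F w := fun w hw hwim =>
    Complex.conj_eq_iff_im.2 (hFreal_im w hw hwim)
  set R : ℂ → ℂ := schwarzReflection F with hR
  have hRd : DifferentiableOn ℂ R U₀ :=
    Complex.differentiableOn_schwarzReflection isOpen_ball hU₀symm hFc hFd hFreal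
  have hRa : AnalyticAt ℂ R 0 := hRd.analyticAt (ball_mem_nhds 0 hρ)
  have hR0 : HasDerivAt R (deriv R 0) 0 := hRa.differentiableAt.hasDerivAt
  have hF0 : F 0 = 0 := by simp [hF]
  have hR00 : R 0 = 0 := by rw [hR, schwarzReflection_of_nonneg (by simp), hF0]
  -- `R'(0)` is real
  have hreal_ev : ∀ᶠ z in 𝓝 (0 : ℂ), z.im = 0 → (R z).im = 0 := by
    filter_upwards [ball_mem_nhds (0 : ℂ) hρ] with z hz hzim
    rw [hR, schwarzReflection_of_nonneg (le_of_eq hzim.symm)]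
    exact hFreal_im z hz hzim
  have hderiv_im : (deriv R 0).im = 0 := im_deriv_eq_zero_of_real (by simp) hRa.differentiableAt hreal_ev
  -- `‖R'(0)‖ ≥ c/2` from the symmetric difference quotients along the axis
  have hderiv_norm : c / 2 ≤ ‖deriv R 0‖ := by
    have hlim : Tendsto (fun t : ℝ => ‖(R t - R (-t)) / (t : ℂ)‖) (𝓝[>] 0) (𝓝 ‖2 * deriv R 0‖) :=
      (continuous_norm.tendsto _).comp (tendsto_symm_slope hR0)
    have hbig : ∀ᶠ t : ℝ in 𝓝[>] 0, c ≤ ‖(R t - R (-t)) / (t : ℂ)‖ := by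
      filter_upwards [Ioo_mem_nhdsGT hρ] with t ht
      have ht0 : (0 : ℝ) < t := ht.1
      have hRt : R t = F t := by rw [hR]; exact schwarzReflection_ofReal t
      have hRmt : R (-t) = F (-t) := by
        rw [hR]; exact schwarzReflection_of_nonneg (by simp)
      have hdiff' : R t - R (-t) = exp (-((θ' : ℂ) * I)) * (h (y + t) - h (y - t)) := by
        rw [hRt, hRmt]
        simp only [hF]
        rw [show (t : ℂ) + y = y + t by ring, show -(t : ℂ) + y = y - t by ring]
        ring
      rw [hdiff', norm_div, norm_mul, show -((θ' : ℂ) * I) = ((-θ' : ℝ) : ℂ) * I by push_cast; ring,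
        Complex.norm_exp_ofReal_mul_I, one_mul, Complex.norm_real, Real.norm_of_nonneg ht0.le,
        le_div_iff₀ ht0]
      exact htan t ht0 ht.2
    have hge : c ≤ ‖2 * deriv R 0‖ := ge_of_tendsto hlim hbig
    rw [norm_mul, Complex.norm_two] at hge
    linarith
  have hd_pos : 0 < ‖deriv R 0‖ := lt_of_lt_of_le (by linarith) hderiv_norm
  -- `|Re R'(0)| = ‖R'(0)‖`
  have hre_abs : |(deriv R 0).re| = ‖deriv R 0‖ := by
    have : deriv R 0 = ((deriv R 0).re : ℂ) := Complex.ext (by simp) (by simp [hderiv_im])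
    conv_rhs => rw [this, Complex.norm_real, Real.norm_eq_abs]
  -- the difference quotient along the normal
  have hpath : Tendsto (fun t : ℝ => (t : ℂ) * I) (𝓝[>] 0) (𝓝[≠] 0) := by
    refine tendsto_nhdsWithin_iff.2 ⟨?_, ?_⟩
    · have : Tendsto (fun t : ℝ => (t : ℂ) * I) (𝓝 0) (𝓝 (((0 : ℝ) : ℂ) * I)) :=
        (Complex.continuous_ofReal.tendsto 0).mul tendsto_const_nhds
      simpa using this.mono_left nhdsWithin_le_nhds
    · filter_upwards [self_mem_nhdsWithin] with t ht
      simpa using ne_of_gt ht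
  have hslopeI : Tendsto (fun t : ℝ => (((t : ℂ) * I)⁻¹ • (R (0 + (t : ℂ) * I) - R 0)).re)
      (𝓝[>] 0) (𝓝 (deriv R 0).re) :=
    (Complex.continuous_re.tendsto _).comp ((hasDerivAt_iff_tendsto_slope_zero.1 hR0).comp hpath)
  have hquot : ∀ t : ℝ, 0 < t → (((t : ℂ) * I)⁻¹ • (R (0 + (t : ℂ) * I) - R 0)).re =
      (R ((t : ℂ) * I)).im / t := by
    intro t ht0
    rw [hR00, sub_zero, zero_add, smul_eq_mul]
    have : ((t : ℂ) * I)⁻¹ = -I / t := by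
      field_simp
      rw [Complex.I_sq]
      ring
    rw [this]
    simp [Complex.mul_re, Complex.div_re, Complex.div_im]
    field_simp
  -- eventually `|Im R(it)|/t ≥ ‖R'(0)‖/2`
  have hev : ∀ᶠ t : ℝ in 𝓝[>] 0, ‖deriv R 0‖ / 2 * t ≤ |(R ((t : ℂ) * I)).im| := by
    have h1 : ∀ᶠ t : ℝ in 𝓝[>] 0, dist ((((t : ℂ) * I)⁻¹ • (R (0 + (t : ℂ) * I) - R 0)).re)
        (deriv R 0).re < ‖deriv R 0‖ / 2 :=
      hslopeI (ball_mem_nhds _ (by linarith))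
    filter_upwards [h1, self_mem_nhdsWithin] with t ht ht0
    have ht0' : (0 : ℝ) < t := ht0
    rw [hquot t ht0', Real.dist_eq] at ht
    have h2 : ‖deriv R 0‖ / 2 ≤ |(R ((t : ℂ) * I)).im / t| := by
      have := abs_sub_abs_le_abs_sub (deriv R 0).re ((R ((t : ℂ) * I)).im / t)
      rw [abs_sub_comm] at ht
      linarith [hre_abs]
    rwa [abs_div, abs_of_pos ht0', le_div_iff₀ ht0'] at h2
  -- extract a radius
  obtain ⟨t₀, ht₀, ht₀P⟩ : ∃ t₀ : ℝ, 0 < t₀ ∧ ∀ t : ℝ, 0 < t → t < t₀ →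
      ‖deriv R 0‖ / 2 * t ≤ |(R ((t : ℂ) * I)).im| := by
    rw [eventually_nhdsWithin_iff, Metric.eventually_nhds_iff] at hev
    obtain ⟨ε, hε, hεP⟩ := hev
    exact ⟨ε, hε, fun t ht htε => hεP (by rw [Real.dist_eq, sub_zero, abs_of_pos ht]; exact htε) ht⟩
  refine ⟨min ρ t₀, lt_min hρ ht₀, min_le_left _ _, ‖deriv R 0‖ / 2, by linarith, ?_, ?_⟩
  · -- the line condition
    intro z hz hzim
    obtain ⟨s, hs⟩ := hline z (ball_subset_ball (min_le_left _ _) hz) hzim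
    rw [hs, ← mul_assoc, hrot, one_mul, ofReal_im]
  · -- the normal growth
    intro t ht htρ
    have hRt : R ((t : ℂ) * I) = F ((t : ℂ) * I) := by
      rw [hR]; exact schwarzReflection_of_nonneg (by simp [ht.le])
    have hval : exp (-((θ' : ℂ) * I)) * (h (y + (t : ℂ) * I) - h y) = R ((t : ℂ) * I) := by
      rw [hRt]
      simp only [hF]
      rw [add_comm ((t : ℂ) * I) y]
    rw [hval]
    exact ht₀P t ht (lt_of_lt_of_le htρ (min_le_right _ _))

/-- **Registered helper `boundaryDataTransfer_reflectionGrowth`** (crux stmt-CriticalPhenomena-14004,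
line `pick-half-plane`, stub `stub_boundaryDataTransfer`, analytic half of (I4)): tangential lower
bound + line + half-disc regularity ⟹ line and linear normal growth in the engine's form, ∀-closed
(`growth_of_tangential`). [folklore] -/
theorem boundaryDataTransfer_reflectionGrowth : ∀ (y u : ℂ) (ρ c : ℝ) (h : ℂ → ℂ), 0 < ρ → 0 < c → ‖u‖ = 1 → DifferentiableOn ℂ h ({z : ℂ | y.im < z.im} ∩ Metric.ball y ρ) → ContinuousOn h ({z : ℂ | y.im ≤ z.im} ∩ Metric.ball y ρ) → (∀ z ∈ Metric.ball y ρ, z.im = y.im → ∃ s : ℝ, h z - h y = u * s) → (∀ t : ℝ, 0 < t → t < ρ → c * t ≤ ‖h (y + t) - h (y - t)‖) → ∃ ρ' : ℝ, 0 < ρ' ∧ ρ' ≤ ρ ∧ ∃ c' : ℝ, 0 < c' ∧ (∀ z ∈ Metric.ball y ρ', z.im = y.im → (Complex.exp (-((u.arg : ℂ) * Complex.I)) * (h z - h y)).im = 0) ∧ (∀ t : ℝ, 0 < t → t < ρ' → c' * t ≤ |(Complex.exp (-((u.arg : ℂ) * Complex.I)) * (h (y + (t : ℂ) * Complex.I)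 - h y)).im|) :=
  fun _ _ _ _ _ hρ hc hu hdiff hcont hline htan => growth_of_tangential hρ hc hu hdiff hcont hline htan

end Summit.CriticalPhenomena.SAWScalingLimit.Theorems.PickHalfPlane.BoundaryDataTransfer

end
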